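import Mathlib
import HarnessLib
import Summits.HubbardSuperconductivity.HubbardSuperconductivity.Theorems.KLProgrammeKLRegimeSplitFieldStrengthTimeMoment
import Summits.HubbardSuperconductivity.HubbardSuperconductivity.Theorems.KLProgrammeKLRegimeSplitTwoLegGridScale

/-!
# Route `KLProgramme` — ENGINE child gen 8 (stmt-HubbardSuperconductivity-20437), stub (e) row B1′ (field strength): (E3d) FROM THE TEMPORAL FIRST MOMENT OF
# A SECTORISED two-leg kernel — the read-out for an ARBITRARY multiplier family (cell gate-hubbard-kl, seat hubbard-kl-r2d-p1 g7, class-#7 text owner)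

Sequel of p1b's `…SplitFieldStrengthTimeMoment` (trivial multiplier: `|z(k⃗,σ) − 1| ≤ 2·Mᵗ`).  A sectorised multiscale tower (stub (b)) bounds position-space
kernels whose legs carry the members `F_ω` of a multiplier family (`sectorisedKernel L M β F G 2 Ω x`, BGM (2.70)–(2.71)), not the unsectorised kernel.  The
Fourier inversion behind the read-out (`sum_sectorisedKernel_mul_conj_prod`, …SectorisedKernelNormExtraction) is family-generic: the `Ω`-sectorised two-leg
kernel tested against the plane waves of the string `(K,σ,+)(K,σ,−)` returns `|Λ|²·F_{ω₀′}(K)F_{ω₁′}(K)·F₂((K,σ,+),(K,σ,−))`.  Hence, if the product of the two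
multipliers takes the SAME nonzero value `a` at the two reading points `K₊ = (ω₀, k⃗)`, `K₋ = (−ω₀, k⃗)` (every cutoff that is a function of `k₀²` — and any
frequency-independent multiplier — has this), p1b's argument goes through verbatim with the `(ω₀′, ω₁′)`-sectorised kernel and a factor `1/‖a‖`:

* §1 `card_sq_mul_prod_mul_kernel_two_eq_sum_family` — the inversion identity for a family;
* §2 **`norm_selfEnergy_omega0_sub_rev_le_of_family_time_moment`** — `‖Σ(ω₀,k⃗,σ) − Σ(−ω₀,k⃗,σ)‖ ≤ 4(π/β)·Mᵗ/‖a‖` from the temporal first moment `Mᵗ` of the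
  `(ω₀′,ω₁′)`-sectorised kernel (leg `0` pinned);
* §3 **`abs_fieldStrengthSpin_sub_one_le_of_family_time_moment`**, `abs_fieldStrength_sub_one_le_of_family_time_moment` (labels and `a` may depend on the
  spin), and the slot form **`abs_klFieldStrength_sub_one_le_of_family_time_moment_sub_counter`** for `G' = 𝒱⁽ⁿ⁾[K] − 𝒩_K` at every scale and frame (the
  counterterm is invisible to `z`, `klFieldStrength_eq_fieldStrength_sub_counter`).

So row B1′ of stub (e) (`|z_n(K_n) − 1| ≤ cz|U|`) is served by a sectorised supplier as soon as, for each shell momentum `k⃗`, ONE pair of labels has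
`F_{ω₀′}F_{ω₁′} = a ≠ 0` at `(±ω₀, k⃗)` (with a partition of unity of `≤ 3` overlapping members, the member covering `k⃗` has `a ≥ 1/9`).  Row B2′ (the shell-tube
gradient of the symmetric interpolant) is a global functional of the lattice readings and is NOT covered here.  Proofs only; no definitions; nothing about
the Hubbard model is asserted; nothing asserts superconductivity.  References: BGM 2006 §2.1 (2.4)–(2.5), §2.3 (2.17), §2.7 (2.70)–(2.71)
[cite: BenfattoGiulianiMastropietro2006]; Salmhofer 1999 App. B.5.5.
-/

noncomputable section

namespace Summit.HubbardSuperconductivity.HubbardSuperconductivity.Theorems.TwoLegFourier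

set_option linter.dupNamespace false -- summit = problem name (single-conjunct summit), D-0017

open Finset Complex
open Literature.MathematicalPhysics.QuantumLattice Literature.Probability.LatticeModels GrassmannAlgebra
open Summit.HubbardSuperconductivity.HubbardSuperconductivity.Theorems.KLRegimeSplit
open Summit.HubbardSuperconductivity.HubbardSuperconductivity.Theorems.KLProgrammeLegKernels

variable {L M : ℕ}

/-! ## §1 Fourier inversion for the two-leg coefficient, arbitrary family -/

/-- **Inversion for the two-leg coefficient with a multiplier family**: with `W = sectorisedKernel β F G 2 ((ω₀′,σ,+),(ω₁′,σ,−))`,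
`|Λ|²·(F_{ω₀′}(K)·F_{ω₁′}(K))·F₂((K,σ,+),(K,σ,−)) = Σ_x W(x)·conj(e^{-iK·x₀} e^{+iK·x₁})`. -/
theorem card_sq_mul_prod_mul_kernel_two_eq_sum_family [NeZero L] {N : ℕ} {β : ℝ} (hβ : β ≠ 0) (F : Fin N → FreqMomentum L M → ℂ)
    (G : HubbardGrassmann L M) (K : FreqMomentum L M) (σ : Fin 2) (ω₀' ω₁' : Fin N) :
    (Fintype.card (SpaceTimeIdx L M) : ℂ) ^ 2 * (F ω₀' K * F ω₁' K) * kernel ℂ G 2 ![((K, σ), 0), ((K, σ), 1)] =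
      ∑ x : Fin 2 → SpaceTimeIdx L M,
        sectorisedKernel L M β F G 2 (![((ω₀', σ), 0), ((ω₁', σ), 1)] : Fin 2 → SectorLeg N) x *
          (starRingEnd ℂ) (hubbardPlaneWave L M β 0 K (x 0) * hubbardPlaneWave L M β 1 K (x 1)) := by
  have h := sum_sectorisedKernel_mul_conj_prod hβ F G 2 (![((ω₀', σ), 0), ((ω₁', σ), 1)] : Fin 2 → SectorLeg N) ![K, K]
  have hX : (fun i : Fin 2 => (((![K, K] : Fin 2 → FreqMomentum L M) i,
      ((![((ω₀', σ), 0), ((ω₁', σ), 1)] : Fin 2 → SectorLeg N) i).1.2), ((![((ω₀', σ), 0), ((ω₁', σ), 1)] : Fin 2 → SectorLeg N) i).2))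
      = ![((K, σ), 0), ((K, σ), 1)] := by
    funext i; fin_cases i <;> rfl
  rw [hX] at h
  simp only [Fin.prod_univ_two, Matrix.cons_val_zero, Matrix.cons_val_one] at h
  rw [← h]

/-! ## §2 The frequency difference of the self-energy from the family time moment -/

/-- **THE FREQUENCY DIFFERENCE OF THE SELF-ENERGY AT `±ω₀` FROM THE TEMPORAL FIRST MOMENT OF A SECTORISED two-leg kernel**: for `β > 0`, any `G`,
any multiplier family `F`, labels `ω₀′, ω₁′` whose product takes the same nonzero value `a` at `K₊ = (ω₀,k⃗)` and `K₋ = (−ω₀,k⃗)`, if the sectorised kernel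
`W(x₀,x₁)` of the string `((ω₀′,σ),+)((ω₁′,σ),−)` satisfies `ε_x Σ_{x : x 0 = x₀} ε_x·circDist_{2M}(t₀,t₁)·‖W(x)‖ ≤ Mᵗ` for every `x₀`, then
`‖Σ(ω₀,k⃗,σ) − Σ(−ω₀,k⃗,σ)‖ ≤ 4(π/β)·Mᵗ/‖a‖`. [cite: BenfattoGiulianiMastropietro2006, §2.1 (2.4)–(2.5), §2.7 (2.70)–(2.71)] -/
theorem norm_selfEnergy_omega0_sub_rev_le_of_family_time_moment [NeZero L] [NeZero M] {N : ℕ} {β : ℝ} (hβ : 0 < β)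
    (F : Fin N → FreqMomentum L M → ℂ) (G : HubbardGrassmann L M) (k : TorusSite 2 L) (σ : Fin 2) (ω₀' ω₁' : Fin N) {a : ℂ} (ha : a ≠ 0)
    (hplus : F ω₀' (omega0 M, k) * F ω₁' (omega0 M, k) = a) (hminus : F ω₀' ((omega0 M).rev, k) * F ω₁' ((omega0 M).rev, k) = a)
    {Mt : ℝ}
    (hMt : ∀ x₀ : SpaceTimeIdx L M, imagTimeWeight β M *
      ∑ x ∈ (univ : Finset (Fin 2 → SpaceTimeIdx L M)).filter (fun x => x 0 = x₀),
        imagTimeWeight β M * (circDist (2 * M) (x 0).1.val (x 1).1.val : ℝ) *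
          ‖sectorisedKernel L M β F G 2 (![((ω₀', σ), 0), ((ω₁', σ), 1)] : Fin 2 → SectorLeg N) x‖ ≤ Mt) :
    ‖selfEnergy L M β G (omega0 M, k) σ - selfEnergy L M β G ((omega0 M).rev, k) σ‖ ≤ 4 * (Real.pi / β) * Mt / ‖a‖ := by
  set W := sectorisedKernel L M β F G 2 (![((ω₀', σ), 0), ((ω₁', σ), 1)] : Fin 2 → SectorLeg N) with hW
  set P : ℝ := (Fintype.card (SpaceTimeIdx L M) : ℝ) with hP
  have hPpos : 0 < P := by
    rw [hP]; exact_mod_cast (Fintype.card_pos_iff.2 ⟨(omega0 M, k)⟩ : 0 < Fintype.card (SpaceTimeIdx L M))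
  have hapos : 0 < ‖a‖ := norm_pos_iff.2 ha
  have hε : 0 ≤ imagTimeWeight β M := imagTimeWeight_nonneg hβ.le M
  have hεP : imagTimeWeight β M * P = β * (L : ℝ) ^ 2 := imagTimeWeight_mul_card β L M
  -- the difference of the two coefficients (times `a`) as one position-space sum
  have hdiff : (P : ℂ) ^ 2 * a * (kernel ℂ G 2 ![(((omega0 M, k), σ), 0), (((omega0 M, k), σ), 1)] -
      kernel ℂ G 2 ![((((omega0 M).rev, k), σ), 0), ((((omega0 M).rev, k), σ), 1)]) =
      ∑ x : Fin 2 → SpaceTimeIdx L M, W x *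
        ((starRingEnd ℂ) (hubbardPlaneWave L M β 0 (omega0 M, k) (x 0) * hubbardPlaneWave L M β 1 (omega0 M, k) (x 1)) -
          (starRingEnd ℂ) (hubbardPlaneWave L M β 0 ((omega0 M).rev, k) (x 0) *
            hubbardPlaneWave L M β 1 ((omega0 M).rev, k) (x 1))) := by
    have h1 := card_sq_mul_prod_mul_kernel_two_eq_sum_family hβ.ne' F G (omega0 M, k) σ ω₀' ω₁'
    have h2 := card_sq_mul_prod_mul_kernel_two_eq_sum_family hβ.ne' F G ((omega0 M).rev, k) σ ω₀' ω₁'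
    rw [hplus] at h1
    rw [hminus] at h2
    have hPc : ((Fintype.card (SpaceTimeIdx L M) : ℕ) : ℂ) = (P : ℂ) := by rw [hP]; norm_cast
    rw [hPc] at h1 h2
    rw [mul_sub, h1, h2, ← sum_sub_distrib]
    exact sum_congr rfl fun x _ => by rw [hW]; ring
  -- norm of the position-space sum: `≤ Σ_x ‖W x‖ · (2π/β) ε circDist`
  have hsum : ‖∑ x : Fin 2 → SpaceTimeIdx L M, W x *
        ((starRingEnd ℂ) (hubbardPlaneWave L M β 0 (omega0 M, k) (x 0) * hubbardPlaneWave L M β 1 (omega0 M, k) (x 1)) -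
          (starRingEnd ℂ) (hubbardPlaneWave L M β 0 ((omega0 M).rev, k) (x 0) *
            hubbardPlaneWave L M β 1 ((omega0 M).rev, k) (x 1)))‖ ≤
      ∑ x : Fin 2 → SpaceTimeIdx L M, 2 * (Real.pi / β) *
        (imagTimeWeight β M * (circDist (2 * M) (x 0).1.val (x 1).1.val : ℝ) * ‖W x‖) := by
    refine (norm_sum_le _ _).trans (sum_le_sum fun x _ => ?_)
    rw [norm_mul, norm_conj_phase_omega0_sub_rev]
    have h := two_abs_sin_time_le hβ (x 0).1 (x 1).1
    have hW0 : 0 ≤ ‖W x‖ := norm_nonneg _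
    nlinarith
  -- slice by the position of leg 0 and use the hypothesis
  have hεpos : 0 < imagTimeWeight β M := by
    unfold imagTimeWeight
    have : (0 : ℝ) < M := by
      have hM : 0 < 2 * M := (omega0 M).pos
      exact_mod_cast Nat.pos_of_mul_pos_left hM
    positivity
  have hslice : ∑ x : Fin 2 → SpaceTimeIdx L M, 2 * (Real.pi / β) *
        (imagTimeWeight β M * (circDist (2 * M) (x 0).1.val (x 1).1.val : ℝ) * ‖W x‖) ≤
      2 * (Real.pi / β) * (P * Mt) / imagTimeWeight β M := by
    rw [le_div_iff₀ hεpos, ← mul_sum]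
    rw [← sum_fiberwise_of_maps_to (s := univ) (t := (univ : Finset (SpaceTimeIdx L M))) (g := fun x => x 0)
      (fun _ _ => mem_univ _)]
    have hP' : P * Mt = ∑ _x₀ : SpaceTimeIdx L M, Mt := by rw [sum_const, card_univ, nsmul_eq_mul, hP]
    rw [mul_assoc, hP', mul_comm (∑ x₀ ∈ univ, _) (imagTimeWeight β M), mul_sum]
    refine mul_le_mul_of_nonneg_left (sum_le_sum fun x₀ _ => ?_) (by positivity)
    refine le_trans (le_of_eq ?_) (hMt x₀)
    rfl
  -- assemble: `Σ₊ − Σ₋ = 2βL²·(F₊ − F₋)`, `βL² = εP`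
  rw [selfEnergy_eq_vertexFn, selfEnergy_eq_vertexFn, ← mul_sub, norm_mul, Complex.norm_real, Real.norm_eq_abs,
    abs_of_nonneg (by positivity)]
  have hker : ‖kernel ℂ G 2 ![(((omega0 M, k), σ), 0), (((omega0 M, k), σ), 1)] -
      kernel ℂ G 2 ![((((omega0 M).rev, k), σ), 0), ((((omega0 M).rev, k), σ), 1)]‖ ≤
      2 * (Real.pi / β) * (P * Mt) / imagTimeWeight β M / (P ^ 2 * ‖a‖) := by
    rw [le_div_iff₀ (by positivity), mul_comm]
    have h := congrArg (fun z : ℂ => ‖z‖) hdiff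
    simp only [norm_mul, norm_pow, Complex.norm_real, Real.norm_eq_abs, abs_of_pos hPpos] at h
    rw [h]
    exact hsum.trans hslice
  calc 2 * (β * (L : ℝ) ^ 2) * ‖kernel ℂ G 2 ![(((omega0 M, k), σ), 0), (((omega0 M, k), σ), 1)] -
        kernel ℂ G 2 ![((((omega0 M).rev, k), σ), 0), ((((omega0 M).rev, k), σ), 1)]‖
      ≤ 2 * (β * (L : ℝ) ^ 2) * (2 * (Real.pi / β) * (P * Mt) / imagTimeWeight β M / (P ^ 2 * ‖a‖)) :=
        mul_le_mul_of_nonneg_left hker (by positivity)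
    _ = 4 * (Real.pi / β) * Mt / ‖a‖ := by
        rw [← hεP]
        field_simp
        ring

/-! ## §3 The field strength -/

/-- **(E3d) FROM A FAMILY TIME MOMENT, per spin**: under the hypotheses of `norm_selfEnergy_omega0_sub_rev_le_of_family_time_moment`,
`|z(k⃗,σ) − 1| ≤ 2·Mᵗ/‖a‖`. -/
theorem abs_fieldStrengthSpin_sub_one_le_of_family_time_moment [NeZero L] [NeZero M] {N : ℕ} {β : ℝ} (hβ : 0 < β)
    (F : Fin N → FreqMomentum L M → ℂ) (G : HubbardGrassmann L M) (k : TorusSite 2 L) (σ : Fin 2) (ω₀' ω₁' : Fin N) {a : ℂ} (ha : a ≠ 0)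
    (hplus : F ω₀' (omega0 M, k) * F ω₁' (omega0 M, k) = a) (hminus : F ω₀' ((omega0 M).rev, k) * F ω₁' ((omega0 M).rev, k) = a)
    {Mt : ℝ}
    (hMt : ∀ x₀ : SpaceTimeIdx L M, imagTimeWeight β M *
      ∑ x ∈ (univ : Finset (Fin 2 → SpaceTimeIdx L M)).filter (fun x => x 0 = x₀),
        imagTimeWeight β M * (circDist (2 * M) (x 0).1.val (x 1).1.val : ℝ) *
          ‖sectorisedKernel L M β F G 2 (![((ω₀', σ), 0), ((ω₁', σ), 1)] : Fin 2 → SectorLeg N) x‖ ≤ Mt) :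
    |fieldStrengthSpin L M β G k σ - 1| ≤ 2 * Mt / ‖a‖ := by
  have h := norm_selfEnergy_omega0_sub_rev_le_of_family_time_moment hβ F G k σ ω₀' ω₁' ha hplus hminus hMt
  have hω : 0 < 2 * (Real.pi / β) := by positivity
  rw [fieldStrengthSpin, sub_sub_cancel_left, abs_neg, abs_div, abs_of_pos hω, div_le_iff₀ hω]
  have him : |(selfEnergy L M β G (omega0 M, k) σ).im - (selfEnergy L M β G ((omega0 M).rev, k) σ).im| ≤
      ‖selfEnergy L M β G (omega0 M, k) σ - selfEnergy L M β G ((omega0 M).rev, k) σ‖ := by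
    rw [← Complex.sub_im]
    exact Complex.abs_im_le_norm _
  calc _ ≤ ‖selfEnergy L M β G (omega0 M, k) σ - selfEnergy L M β G ((omega0 M).rev, k) σ‖ := him
    _ ≤ 4 * (Real.pi / β) * Mt / ‖a‖ := h
    _ = 2 * Mt / ‖a‖ * (2 * (Real.pi / β)) := by ring

/-- **(E3d) for the spin-averaged field strength from family time moments** (labels `ω σ` and values `a σ` may depend on the spin; both spin strings):
`|z(k⃗) − 1| ≤ Mᵗ/‖a 0‖ + Mᵗ/‖a 1‖`. -/
theorem abs_fieldStrength_sub_one_le_of_family_time_moment [NeZero L] [NeZero M] {N : ℕ} {β : ℝ} (hβ : 0 < β)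
    (F : Fin N → FreqMomentum L M → ℂ) (G : HubbardGrassmann L M) (k : TorusSite 2 L) (ω₀' ω₁' : Fin 2 → Fin N) {a : Fin 2 → ℂ}
    (ha : ∀ σ, a σ ≠ 0) (hplus : ∀ σ, F (ω₀' σ) (omega0 M, k) * F (ω₁' σ) (omega0 M, k) = a σ)
    (hminus : ∀ σ, F (ω₀' σ) ((omega0 M).rev, k) * F (ω₁' σ) ((omega0 M).rev, k) = a σ) {Mt : ℝ}
    (hMt : ∀ (σ : Fin 2) (x₀ : SpaceTimeIdx L M), imagTimeWeight β M *
      ∑ x ∈ (univ : Finset (Fin 2 → SpaceTimeIdx L M)).filter (fun x => x 0 = x₀),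
        imagTimeWeight β M * (circDist (2 * M) (x 0).1.val (x 1).1.val : ℝ) *
          ‖sectorisedKernel L M β F G 2 (![((ω₀' σ, σ), 0), ((ω₁' σ, σ), 1)] : Fin 2 → SectorLeg N) x‖ ≤ Mt) :
    |fieldStrength L M β G k - 1| ≤ Mt / ‖a 0‖ + Mt / ‖a 1‖ := by
  have h0 := abs_fieldStrengthSpin_sub_one_le_of_family_time_moment hβ F G k 0 (ω₀' 0) (ω₁' 0) (ha 0) (hplus 0) (hminus 0) (hMt 0)
  have h1 := abs_fieldStrengthSpin_sub_one_le_of_family_time_moment hβ F G k 1 (ω₀' 1) (ω₁' 1) (ha 1) (hplus 1) (hminus 1) (hMt 1)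
  rw [fieldStrength]
  have : (fieldStrengthSpin L M β G k 0 + fieldStrengthSpin L M β G k 1) / 2 - 1 =
      ((fieldStrengthSpin L M β G k 0 - 1) + (fieldStrengthSpin L M β G k 1 - 1)) / 2 := by ring
  rw [this, abs_div, abs_two]
  have htri := abs_add_le (fieldStrengthSpin L M β G k 0 - 1) (fieldStrengthSpin L M β G k 1 - 1)
  have e0 : 2 * Mt / ‖a 0‖ = 2 * (Mt / ‖a 0‖) := by ring
  have e1 : 2 * Mt / ‖a 1‖ = 2 * (Mt / ‖a 1‖) := by ring
  rw [e0] at h0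
  rw [e1] at h1
  linarith

/-- **The slot form, every scale and frame, counterterm subtracted**: for `G' = klEffectiveAction … K klE0 n − counterQuadratic … K` (the counterterm is
invisible to the field strength, `klFieldStrength_eq_fieldStrength_sub_counter`), family time moments of the sectorised two-leg kernels of `G'` with label
products `a σ ≠ 0` agreeing at `(±ω₀, k⃗)` give `|klFieldStrength … K n k⃗ − 1| ≤ Mᵗ/‖a 0‖ + Mᵗ/‖a 1‖` — row B1′ of stub (e) from a SECTORISED supplier. -/
theorem abs_klFieldStrength_sub_one_le_of_family_time_moment_sub_counter [NeZero L] [NeZero M] {N : ℕ} {β : ℝ} (hβ : 0 < β) (U μ : ℝ)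
    (K : TrigPolyC4v) (n : ℕ) (F : Fin N → FreqMomentum L M → ℂ) (k : TorusSite 2 L) (ω₀' ω₁' : Fin 2 → Fin N) {a : Fin 2 → ℂ}
    (ha : ∀ σ, a σ ≠ 0) (hplus : ∀ σ, F (ω₀' σ) (omega0 M, k) * F (ω₁' σ) (omega0 M, k) = a σ)
    (hminus : ∀ σ, F (ω₀' σ) ((omega0 M).rev, k) * F (ω₁' σ) ((omega0 M).rev, k) = a σ) {Mt : ℝ}
    (hMt : ∀ (σ : Fin 2) (x₀ : SpaceTimeIdx L M), imagTimeWeight β M *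
      ∑ x ∈ (univ : Finset (Fin 2 → SpaceTimeIdx L M)).filter (fun x => x 0 = x₀),
        imagTimeWeight β M * (circDist (2 * M) (x 0).1.val (x 1).1.val : ℝ) *
          ‖sectorisedKernel L M β F (klEffectiveAction L M β U μ K klE0 n - counterQuadratic L M β K) 2
            (![((ω₀' σ, σ), 0), ((ω₁' σ, σ), 1)] : Fin 2 → SectorLeg N) x‖ ≤ Mt) :
    |klFieldStrength L M β U μ K n k - 1| ≤ Mt / ‖a 0‖ + Mt / ‖a 1‖ := by
  rw [klFieldStrength_eq_fieldStrength_sub_counter hβ.ne' U μ K n]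
  exact abs_fieldStrength_sub_one_le_of_family_time_moment hβ F _ k ω₀' ω₁' ha hplus hminus hMt

end Summit.HubbardSuperconductivity.HubbardSuperconductivity.Theorems.TwoLegFourier

end
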